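import Literature.Geometry.Kaehler.ComplexTorusDivisorMultiplicitySingularPoints
import Literature.Geometry.Kaehler.ComplexTorusDivisorBoxProduct
import Literature.Geometry.Kaehler.ComplexTorusDivisorIsogenyPullback
import Literature.Geometry.Kaehler.ComplexTorusDivisorMultiplicationPullback
import HarnessLib

/-!
# `mult_x(D)` under pull-backs: isogenies (`mult_x(f^* D') = mult_{f(x)}(D')`), `n_X`, sums
# (`Sing(D₁ + D₂) = Sing D₁ ∪ Sing D₂ ∪ (|D₁| ∩ |D₂|)`) and box products
# (`Sing(D₁ × X₂ + X₁ × D₂) = (|D₁| × |D₂|) ∪ (Sing D₁ × X₂) ∪ (X₁ × Sing D₂)`)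

[tag: lange-cav-complex-tori] [linked: HodgeConjecture (lit-hodgefound SKELETON §A2, row A2-173)]

Layer `Literature/Geometry/Kaehler`, namespaces `Literature.Geometry.Kaehler.SCV` (§1) and
`Literature.Geometry.Kaehler.ComplexTorus` (§2–§4); lane `lit-hodgefound` (Track 2 foundations library),
skeleton seat `lit-hodgefound-skel-2` (generation 40), plan row A2-173. The point multiplicity `mult_x(D)`
of A2-168 (`divisorMultAt`, "the subdegree of the Taylor expansion of `ϑ`") read through the pull-back
rows: A2-156 `ComplexTorusDivisorIsogenyPullback` (`(ϑ' ∘ F) = f^*(ϑ')`), A2-157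
`ComplexTorusDivisorMultiplicationPullback` (`n_X^*`), A2-161 `ComplexTorusDivisorBoxProduct`
(`(ϑ₁ ∘ pr₁) = pr₁^*(ϑ₁)`, `(ϑ₁ ⊠ ϑ₂) = pr₁^*(ϑ₁) + pr₂^*(ϑ₂)`) and A2-168's additivity
`mult_x(D₁ + D₂) = mult_x(D₁) + mult_x(D₂)`; with A2-171 (`{mult_x ≥ 2} = Sing`), the singular loci of sums
and of box products. Theorems only; no definition, no named fact.

Sources, VERBATIM. E. M. Chirka, *Complex Analytic Sets* (1989) [held `book:chirkand-complex-analytic-sets`],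
§1.5 (p. 10–11): "`ord_a f` […] the minimum of the orders of its restrictions to complex lines", "Clearly,
`ord_a(f · g) = ord_a f + ord_a g`"; the order is a biholomorphic invariant (§1.5, expansions "in `z − a`"
in any local coordinates).  W. Fulton, *Intersection Theory* (1998), §1.7 (p. 18): flat pull-back
"`f^*[V] = [f⁻¹(V)]`", Example 1.7.6; §1.10 Prop. 1.10 (a) "`α × β = p^*(α)`".  H. Lange, *Abelian
Varieties over the Complex Numbers* (2023) [held `book:lange1992-complex-abelian-varieties`], §2.3.4
(p. 105 L20; proof of Prop. 2.3.14, p. 106 L3: "`mult_x(D) = mult_0(t_x^*D)`"), §6.2.1 (p0301 L1–L3: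
"`f^* W = f⁻¹ W`"), §2.1.6 Exercise (7) (p. 88), §5.1 Lemma 5.1.1 (the divisors `Θ₁ × X₂ + X₁ × D`).
S. Grushevsky, *The Schottky problem* (MSRI Publ. 59, 2012), §5 (p. 11): "we see that
`𝒜_g^{dec} ⊂ N_{g−2,g}`" (for a decomposable p.p.a.v. `Θ = Θ₁ × X₂ + X₁ × Θ₂` is singular along
`Θ₁ × Θ₂`).

## Contents

* §1 (SCV) `lineOrder_comp_clm`, `pointOrder_le_pointOrder_comp_clm`,
  **`pointOrder_comp_clm_of_surjective`** (`ord_v(f ∘ P) = ord_{Pv}(f)` for a continuous linear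
  surjection `P`), `pointOrder_comp_continuousLinearEquiv`.
* §2 isogenies: **`IsIsogeny.divisorMultAt_pullbackChain`** (`mult_x(f^* D') = mult_{f(x)}(D')`),
  **`IsIsogeny.setOf_two_le_divisorMultAt_pullbackChain`** (`Sing(f^* D') = f⁻¹ Sing D'`),
  **`divisorMultAt_pullbackChain_mulN`** (`mult_x(n_X^* D) = mult_{nx}(D)`).
* §3 sums: `two_le_add_iff` (in `ℕ∞`), **`two_le_divisorMultAt_add_iff`**,
  **`setOf_two_le_divisorMultAt_add`** (`Sing(D₁ + D₂) = Sing D₁ ∪ Sing D₂ ∪ (|D₁| ∩ |D₂|)`),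
  `inter_support_subset_setOf_two_le_divisorMultAt_add`.
* §4 box products on `X₁ × X₂ = ComplexTorus (prodPeriodL2 Φ₁ Φ₂)`: **`divisorMultAt_fstPullbackChain_cover`**
  (`mult_{(x₁,x₂)}(pr₁^* D₁) = mult_{x₁}(D₁)`), `…snd…`, **`divisorMultAt_fstPullbackChain_add_sndPullbackChain_cover`**
  (`mult_{(x₁,x₂)}(D₁ × X₂ + X₁ × D₂) = mult_{x₁}(D₁) + mult_{x₂}(D₂)`),
  **`two_le_divisorMultAt_boxProd_iff`** (`(x₁,x₂) ∈ Sing(D₁ × X₂ + X₁ × D₂) ⟺ x₁ ∈ Sing D₁ ∨ x₂ ∈ Sing D₂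
  ∨ (x₁ ∈ |D₁| ∧ x₂ ∈ |D₂|)`), `two_le_divisorMultAt_boxProd_of_mem_support` (`|D₁| × |D₂| ⊆ Sing`).

## What is NOT here

* `dim Sing = g − 2` for decomposable p.p.a.v. (dimension theory of `|D₁| × |D₂|`); push-forwards.

## References

* [Chirka1989] E. M. Chirka, *Complex Analytic Sets* (1989), §1.5 (pp. 10–11).
* [Fulton1998] W. Fulton, *Intersection Theory*, 2nd ed. (1998), §1.7 (p. 18), Example 1.7.6, §1.10
  Prop. 1.10 (a).
* [Lange2023AbelianVarietiesComplex] H. Lange, *Abelian Varieties over the Complex Numbers* (2023), §2.3.4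
  (p. 105 L20, p. 106 L3), §6.2.1 (p. 301), §2.1.6 Exercise (7) (p. 88), §5.1 Lemma 5.1.1.
* [Grushevsky2012SchottkyProblem] S. Grushevsky, *The Schottky problem*, MSRI Publ. 59 (2012), §5 (p. 11).
-/

noncomputable section

open scoped Manifold Topology
open Set Function Module WithLp

namespace Literature.Geometry.Kaehler

universe u v

/-! ### §1 SCV: the order under linear surjections -/

namespace SCV

variable {E E' : Type*} [NormedAddCommGroup E] [NormedSpace ℂ E] [NormedAddCommGroup E'] [NormedSpace ℂ E']

/-- `ord_0 (f ∘ P)_{v,w} = ord_0 f_{Pv, Pw}` for a continuous linear `P` (`(f ∘ P)(v + λw) = f(Pv + λ Pw)`).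
[cite: Chirka1989, §1.5 Prop. 1 (p. 11: "`f_v(λ) = f(a + λv)`")] -/
theorem lineOrder_comp_clm (P : E →L[ℂ] E') (f : E' → ℂ) (v w : E) :
    lineOrder (fun u => f (P u)) v w = lineOrder f (P v) (P w) := by
  simp only [lineOrder_def, map_add, map_smul]

/-- `ord_{Pv}(f) ≤ ord_v(f ∘ P)` for every continuous linear `P` (fewer lines through `Pv` are tested).
[cite: Chirka1989, §1.5 Prop. 1 (p. 11: "the minimum of the orders of its restrictions to complex lines")] -/
theorem pointOrder_le_pointOrder_comp_clm (P : E →L[ℂ] E') (f : E' → ℂ) (v : E) :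
    pointOrder f (P v) ≤ pointOrder (fun u => f (P u)) v := by
  rw [pointOrder_def, pointOrder_def]
  simp only [lineOrder_comp_clm]
  exact le_iInf fun w => iInf_le _ (P w)

/-- **`ord_v(f ∘ P) = ord_{Pv}(f)` for a continuous linear SURJECTION `P`** (the lines through `Pv` are
exactly the images of the lines through `v`). [cite: Chirka1989, §1.5 Prop. 1 (p. 11)] -/
theorem pointOrder_comp_clm_of_surjective (P : E →L[ℂ] E') (hP : Surjective P) (f : E' → ℂ) (v : E) :
    pointOrder (fun u => f (P u)) v = pointOrder f (P v) := by
  simp only [pointOrder_def, lineOrder_comp_clm]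
  exact hP.iInf_comp fun w => lineOrder f (P v) w

/-- **`ord_v(f ∘ A) = ord_{Av}(f)` for a continuous linear isomorphism `A`**: the order is a biholomorphic
(here: linear) invariant. [cite: Chirka1989, §1.5 (p. 10–11)] -/
theorem pointOrder_comp_continuousLinearEquiv (A : E ≃L[ℂ] E') (f : E' → ℂ) (v : E) :
    pointOrder (fun u => f (A u)) v = pointOrder f (A v) :=
  pointOrder_comp_clm_of_surjective (A : E →L[ℂ] E') A.surjective f v

end SCV

namespace ComplexTorus

/-! ### §2 Isogenies: `mult_x(f^* D') = mult_{f(x)}(D')` -/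

section Isogeny

variable {ι ι' : Type*} [Fintype ι] [Fintype ι'] {E : Type u} {E' : Type v}
  [NormedAddCommGroup E] [InnerProductSpace ℂ E] [FiniteDimensional ℂ E]
  [NormedAddCommGroup E'] [InnerProductSpace ℂ E'] [FiniteDimensional ℂ E']
  (Φ : (ι → ℝ) ≃L[ℝ] E) (Φ' : (ι' → ℝ) ≃L[ℝ] E') (d : ℕ) {n : ℕ} (e : Fin n ≃ ι) (e' : Fin n ≃ ι')
  (h : 2 * d + 2 = n) {A : Matrix ι' ι ℤ} {F : E →L[ℂ] E'}
  {η' : E' [⋀^Fin 2]→L[ℝ] ℝ} {χ' : (ι' → ℤ) → ℂ}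

include e e' h in
/-- **`mult_x(f^* D') = mult_{f(x)}(D')` FOR AN ISOGENY `f = ρ(A) : X → X'`** with analytic representation
`F` (`Φ' ∘ A_ℝ = F ∘ Φ`) and `D' ∈ |L(H', χ')|`: `f^*(ϑ') = (ϑ' ∘ F)` (A2-156) and `ord_v(ϑ' ∘ F) =
ord_{Fv}(ϑ')` (`F` is a linear isomorphism). In particular `mult_x(D) = mult_0(t_x^* D)`-type statements
hold along every étale covering. [cite: Fulton1998, §1.7 (p. 18) and Example 1.7.6] [cite: Lange2023AbelianVarietiesComplex, §6.2.1 (p0301 L1–L3: "`f^* W = f⁻¹ W`") and §2.3.4 (p. 106 L3)] [cite: Chirka1989, §1.5 (p. 10–11)] -/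
theorem IsIsogeny.divisorMultAt_pullbackChain (hA : IsIsogeny Φ Φ' A)
    (hF : ∀ x, Φ' ((A.map (Int.cast : ℤ → ℝ)).mulVec x) = F (Φ x))
    (hη' : IsNSForm Φ' η') (hχ' : IsSemicharacter Φ' η' χ')
    {D' : HolomorphicChain 𝓘(ℂ, E') (ComplexTorus Φ') d} (hD' : D' ∈ linearSystem Φ' d η' χ')
    (x : ComplexTorus Φ) :
    divisorMultAt Φ d (hA.pullbackChain Φ Φ' D') x = divisorMultAt Φ' d D' (mapMatrix Φ Φ' A x) := by
  classical
  obtain ⟨ϑ', hϑ', hϑ'0, rfl⟩ := hD'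
  obtain ⟨v, rfl⟩ := cover_surjective Φ x
  have hbij : Bijective F :=
    (analyticRep_bijective_iff Φ Φ' hF).2 ((isIsogeny_iff_mulVec_bijective Φ Φ' A).1 hA).2
  have hmem := comp_analyticRep_mem_thetaFunctions Φ Φ' hF hϑ'
  have hne : (fun w => ϑ' (F w)) ≠ 0 :=
    comp_ne_zero_of_surjective Φ Φ' hF hA.surjective (isFactor_canonicalFactor Φ' hη' hχ') hϑ' hϑ'0
  rw [← hA.divisorChain_comp Φ Φ' d e e' h hF hη' hχ' hϑ' hϑ'0,
    divisorMultAt_divisorChain_cover e h (hη'.pullback Φ Φ' hF) (hχ'.pullback Φ Φ' hF) hmem hne v,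
    ← cover_apply_analyticRep Φ Φ' hF v, divisorMultAt_divisorChain_cover e' h hη' hχ' hϑ' hϑ'0 (F v)]
  exact SCV.pointOrder_comp_clm_of_surjective F hbij.2 ϑ' v

include e e' h in
/-- **`{x : mult_x(f^* D') ≥ k} = f⁻¹{x' : mult_{x'}(D') ≥ k}`** — in particular `Sing(f^* D') = f⁻¹ Sing D'`
for an isogeny (a local biholomorphism). [cite: Fulton1998, §1.7 (p. 18)] [cite: Chirka1989, §1.5 (p. 10–11)] -/
theorem IsIsogeny.setOf_le_divisorMultAt_pullbackChain (hA : IsIsogeny Φ Φ' A)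
    (hF : ∀ x, Φ' ((A.map (Int.cast : ℤ → ℝ)).mulVec x) = F (Φ x))
    (hη' : IsNSForm Φ' η') (hχ' : IsSemicharacter Φ' η' χ')
    {D' : HolomorphicChain 𝓘(ℂ, E') (ComplexTorus Φ') d} (hD' : D' ∈ linearSystem Φ' d η' χ') (k : ℕ∞) :
    {x | k ≤ divisorMultAt Φ d (hA.pullbackChain Φ Φ' D') x} =
      mapMatrix Φ Φ' A ⁻¹' {x' | k ≤ divisorMultAt Φ' d D' x'} := by
  ext x
  rw [mem_setOf_eq, hA.divisorMultAt_pullbackChain Φ Φ' d e e' h hF hη' hχ' hD', mem_preimage, mem_setOf_eq]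

end Isogeny

section MulN

variable {ι : Type*} [Fintype ι] [DecidableEq ι] {E : Type u} [NormedAddCommGroup E]
  [InnerProductSpace ℂ E] [FiniteDimensional ℂ E] (Φ : (ι → ℝ) ≃L[ℝ] E) (d : ℕ) {n : ℕ}
  (e : Fin n ≃ ι) (h : 2 * d + 2 = n) {η : E [⋀^Fin 2]→L[ℝ] ℝ} {χ : (ι → ℤ) → ℂ}

include e h in
/-- **`mult_x(n_X^* D) = mult_{nx}(D)`** for `n ≠ 0` and `D ∈ |L(H, χ)|` (`n_X = ρ(n·1)` with analytic
representation `n · id_V`, A2-157). [cite: Lange2023AbelianVarietiesComplex, §1.3.3 Prop. 1.3.7 (p. 40) and §6.2.1 (p0301)] [cite: Fulton1998, §1.7 Example 1.7.6] -/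
theorem divisorMultAt_pullbackChain_mulN {k : ℤ} (hk : k ≠ 0) (hη : IsNSForm Φ η)
    (hχ : IsSemicharacter Φ η χ) {D : HolomorphicChain 𝓘(ℂ, E) (ComplexTorus Φ) d}
    (hD : D ∈ linearSystem Φ d η χ) (x : ComplexTorus Φ) :
    divisorMultAt Φ d ((isIsogeny_smul_one Φ hk).pullbackChain Φ Φ D) x =
      divisorMultAt Φ d D (mapMatrix Φ Φ (k • (1 : Matrix ι ι ℤ)) x) :=
  (isIsogeny_smul_one Φ hk).divisorMultAt_pullbackChain Φ Φ d e e h (analyticRep_smul_one Φ k) hη hχ hD x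

include e h in
/-- `mult_{π(v)}(n_X^* D) = mult_{π(nv)}(D)`. [cite: Lange2023AbelianVarietiesComplex, §1.3.3 Prop. 1.3.7 (p. 40)] -/
theorem divisorMultAt_pullbackChain_mulN_cover {k : ℤ} (hk : k ≠ 0) (hη : IsNSForm Φ η)
    (hχ : IsSemicharacter Φ η χ) {D : HolomorphicChain 𝓘(ℂ, E) (ComplexTorus Φ) d}
    (hD : D ∈ linearSystem Φ d η χ) (v : E) :
    divisorMultAt Φ d ((isIsogeny_smul_one Φ hk).pullbackChain Φ Φ D) (cover Φ v) =
      divisorMultAt Φ d D (cover Φ ((k : ℂ) • v)) := by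
  rw [divisorMultAt_pullbackChain_mulN Φ d e h hk hη hχ hD, mapMatrix_smul_one_cover]

end MulN

/-! ### §3 Sums: `Sing(D₁ + D₂) = Sing D₁ ∪ Sing D₂ ∪ (|D₁| ∩ |D₂|)` -/

section Sum

variable {ι : Type*} [Fintype ι] {E : Type u} [NormedAddCommGroup E] [InnerProductSpace ℂ E]
  [FiniteDimensional ℂ E] {Φ : (ι → ℝ) ≃L[ℝ] E} {d : ℕ} {n : ℕ} (e : Fin n ≃ ι) (h : 2 * d + 2 = n)
  {η η' : E [⋀^Fin 2]→L[ℝ] ℝ} {χ χ' : (ι → ℤ) → ℂ}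

/-- `a + b ≥ 2 ⟺ a ≥ 2 ∨ b ≥ 2 ∨ (a ≥ 1 ∧ b ≥ 1)` in `ℕ∞`. [folklore] -/
private theorem two_le_add_iff (a b : ℕ∞) : 2 ≤ a + b ↔ 2 ≤ a ∨ 2 ≤ b ∨ (1 ≤ a ∧ 1 ≤ b) := by
  induction a using ENat.recTopCoe with
  | top => simp
  | coe a =>
    induction b using ENat.recTopCoe with
    | top => simp
    | coe b =>
      norm_cast
      omega

include e h in
/-- **`mult_x(D₁ + D₂) ≥ 2 ⟺ mult_x(D₁) ≥ 2 ∨ mult_x(D₂) ≥ 2 ∨ x ∈ |D₁| ∩ |D₂|`** (`Dᵢ ∈ |Lᵢ|`;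
additivity of `mult_x`, A2-168). [cite: Chirka1989, §1.5 (p. 11: "`ord_a(f · g) = ord_a f + ord_a g`")] [cite: Lange2023AbelianVarietiesComplex, §2.3.4 (p. 105 L20)] -/
theorem two_le_divisorMultAt_add_iff (hη : IsNSForm Φ η) (hχ : IsSemicharacter Φ η χ) (hη' : IsNSForm Φ η')
    (hχ' : IsSemicharacter Φ η' χ') {D₁ D₂ : HolomorphicChain 𝓘(ℂ, E) (ComplexTorus Φ) d}
    (hD₁ : D₁ ∈ linearSystem Φ d η χ) (hD₂ : D₂ ∈ linearSystem Φ d η' χ') (x : ComplexTorus Φ) :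
    2 ≤ divisorMultAt Φ d (D₁ + D₂) x ↔
      2 ≤ divisorMultAt Φ d D₁ x ∨ 2 ≤ divisorMultAt Φ d D₂ x ∨ (x ∈ D₁.support ∧ x ∈ D₂.support) := by
  rw [divisorMultAt_add e h hη hχ hη' hχ' hD₁ hD₂, two_le_add_iff, one_le_divisorMultAt_iff e h hη hχ hD₁,
    one_le_divisorMultAt_iff e h hη' hχ' hD₂]

include e h in
/-- **`Sing(D₁ + D₂) = Sing D₁ ∪ Sing D₂ ∪ (|D₁| ∩ |D₂|)`** for `D₁ ∈ |L(H, χ)|`, `D₂ ∈ |L(H', χ')|`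
(`Sing D := {x : mult_x(D) ≥ 2}`): a sum of effective divisors is singular along their intersection.
[cite: Chirka1989, §1.5 (p. 11)] [cite: Grushevsky2012SchottkyProblem, §5 (p. 11: `𝒜_g^{dec} ⊂ N_{g−2,g}`)] -/
theorem setOf_two_le_divisorMultAt_add (hη : IsNSForm Φ η) (hχ : IsSemicharacter Φ η χ) (hη' : IsNSForm Φ η')
    (hχ' : IsSemicharacter Φ η' χ') {D₁ D₂ : HolomorphicChain 𝓘(ℂ, E) (ComplexTorus Φ) d}
    (hD₁ : D₁ ∈ linearSystem Φ d η χ) (hD₂ : D₂ ∈ linearSystem Φ d η' χ') :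
    {x | 2 ≤ divisorMultAt Φ d (D₁ + D₂) x} =
      {x | 2 ≤ divisorMultAt Φ d D₁ x} ∪ {x | 2 ≤ divisorMultAt Φ d D₂ x} ∪ (D₁.support ∩ D₂.support) := by
  ext x
  simp only [mem_setOf_eq, mem_union, mem_inter_iff, two_le_divisorMultAt_add_iff e h hη hχ hη' hχ' hD₁ hD₂ x,
    or_assoc]

include e h in
/-- **`|D₁| ∩ |D₂| ⊆ Sing(D₁ + D₂)`.** [cite: Chirka1989, §1.5 (p. 11)] [cite: Grushevsky2012SchottkyProblem, §5 (p. 11)] -/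
theorem inter_support_subset_setOf_two_le_divisorMultAt_add (hη : IsNSForm Φ η) (hχ : IsSemicharacter Φ η χ)
    (hη' : IsNSForm Φ η') (hχ' : IsSemicharacter Φ η' χ') {D₁ D₂ : HolomorphicChain 𝓘(ℂ, E) (ComplexTorus Φ) d}
    (hD₁ : D₁ ∈ linearSystem Φ d η χ) (hD₂ : D₂ ∈ linearSystem Φ d η' χ') :
    D₁.support ∩ D₂.support ⊆ {x | 2 ≤ divisorMultAt Φ d (D₁ + D₂) x} := fun x hx =>
  (two_le_divisorMultAt_add_iff e h hη hχ hη' hχ' hD₁ hD₂ x).2 (Or.inr (Or.inr hx))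

include e h in
/-- `Sing D₁ ∪ Sing D₂ ⊆ Sing(D₁ + D₂)` (multiplicities only grow). [cite: Chirka1989, §1.5 (p. 11)] -/
theorem setOf_two_le_divisorMultAt_union_subset_add (hη : IsNSForm Φ η) (hχ : IsSemicharacter Φ η χ)
    (hη' : IsNSForm Φ η') (hχ' : IsSemicharacter Φ η' χ') {D₁ D₂ : HolomorphicChain 𝓘(ℂ, E) (ComplexTorus Φ) d}
    (hD₁ : D₁ ∈ linearSystem Φ d η χ) (hD₂ : D₂ ∈ linearSystem Φ d η' χ') :
    {x | 2 ≤ divisorMultAt Φ d D₁ x} ∪ {x | 2 ≤ divisorMultAt Φ d D₂ x} ⊆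
      {x | 2 ≤ divisorMultAt Φ d (D₁ + D₂) x} := by
  rw [setOf_two_le_divisorMultAt_add e h hη hχ hη' hχ' hD₁ hD₂]
  exact subset_union_left

end Sum

/-! ### §4 Box products: `mult_{(x₁,x₂)}(D₁ × X₂ + X₁ × D₂) = mult_{x₁}(D₁) + mult_{x₂}(D₂)` -/

section BoxProduct

variable {ι₁ ι₂ : Type*} [Fintype ι₁] [Fintype ι₂] [DecidableEq ι₁] [DecidableEq ι₂] {E₁ E₂ : Type u}
  [NormedAddCommGroup E₁] [InnerProductSpace ℂ E₁] [FiniteDimensional ℂ E₁]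
  [NormedAddCommGroup E₂] [InnerProductSpace ℂ E₂] [FiniteDimensional ℂ E₂]
  (Φ₁ : (ι₁ → ℝ) ≃L[ℝ] E₁) (Φ₂ : (ι₂ → ℝ) ≃L[ℝ] E₂) {d₁ d₂ : ℕ} {n₁ n₂ : ℕ}
  (e₁ : Fin n₁ ≃ ι₁) (e₂ : Fin n₂ ≃ ι₂) (h₁ : 2 * d₁ + 2 = n₁) (h₂ : 2 * d₂ + 2 = n₂)
  {η₁ : E₁ [⋀^Fin 2]→L[ℝ] ℝ} {η₂ : E₂ [⋀^Fin 2]→L[ℝ] ℝ} {χ₁ : (ι₁ → ℤ) → ℂ} {χ₂ : (ι₂ → ℤ) → ℂ}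

omit [Fintype ι₁] [Fintype ι₂] [DecidableEq ι₁] [DecidableEq ι₂] [NormedAddCommGroup E₁]
  [InnerProductSpace ℂ E₁] [FiniteDimensional ℂ E₁] [NormedAddCommGroup E₂] [InnerProductSpace ℂ E₂]
  [FiniteDimensional ℂ E₂] in
/-- Rank bookkeeping of the product: `2(d₁ + d₂ + 1) + 2 = n₁ + n₂`. [folklore] -/
private theorem two_mul_add_eq'' (h₁ : 2 * d₁ + 2 = n₁) (h₂ : 2 * d₂ + 2 = n₂) :
    2 * (d₁ + d₂ + 1) + 2 = n₁ + n₂ := by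
  omega

omit [Fintype ι₁] [Fintype ι₂] [DecidableEq ι₁] [DecidableEq ι₂] [NormedAddCommGroup E₁] [InnerProductSpace ℂ E₁]
  [FiniteDimensional ℂ E₁] [InnerProductSpace ℂ E₂] [FiniteDimensional ℂ E₂] in
/-- `ϑ₁ ∘ pr₁ ≢ 0` for `ϑ₁ ≢ 0`. [folklore] -/
private theorem comp_fst_ne_zero' {ϑ₁ : E₁ → ℂ} (hϑ₁0 : ϑ₁ ≠ 0) :
    (fun z : WithLp 2 (E₁ × E₂) => ϑ₁ (ofLp z).1) ≠ 0 := by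
  obtain ⟨v, hv⟩ := Function.ne_iff.1 hϑ₁0
  exact Function.ne_iff.2 ⟨toLp 2 (v, 0), by simpa using hv⟩

omit [Fintype ι₁] [Fintype ι₂] [DecidableEq ι₁] [DecidableEq ι₂] [InnerProductSpace ℂ E₁]
  [FiniteDimensional ℂ E₁] [NormedAddCommGroup E₂] [InnerProductSpace ℂ E₂] [FiniteDimensional ℂ E₂] in
/-- `ϑ₂ ∘ pr₂ ≢ 0` for `ϑ₂ ≢ 0`. [folklore] -/
private theorem comp_snd_ne_zero' {ϑ₂ : E₂ → ℂ} (hϑ₂0 : ϑ₂ ≠ 0) :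
    (fun z : WithLp 2 (E₁ × E₂) => ϑ₂ (ofLp z).2) ≠ 0 := by
  obtain ⟨v, hv⟩ := Function.ne_iff.1 hϑ₂0
  exact Function.ne_iff.2 ⟨toLp 2 (0, v), by simpa using hv⟩

omit [Fintype ι₁] [Fintype ι₂] [DecidableEq ι₁] [DecidableEq ι₂] [InnerProductSpace ℂ E₁] [FiniteDimensional ℂ E₁]
  [InnerProductSpace ℂ E₂] [FiniteDimensional ℂ E₂] [NormedAddCommGroup E₁] [NormedAddCommGroup E₂] in
/-- `ord_z(ϑ₁ ∘ pr₁) = ord_{z₁}(ϑ₁)` on `V₁ × V₂` (the first projection is a linear surjection).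
[cite: Chirka1989, §1.5 (p. 10–11)] [cite: Fulton1998, §1.7 Prop. 1.7] -/
theorem _root_.Literature.Geometry.Kaehler.SCV.pointOrder_comp_fst_ofLp
    {V₁ V₂ : Type*} [NormedAddCommGroup V₁] [NormedSpace ℂ V₁] [NormedAddCommGroup V₂] [NormedSpace ℂ V₂]
    (f : V₁ → ℂ) (z : WithLp 2 (V₁ × V₂)) :
    SCV.pointOrder (fun w : WithLp 2 (V₁ × V₂) => f (ofLp w).1) z = SCV.pointOrder f (ofLp z).1 := by
  set P : WithLp 2 (V₁ × V₂) →L[ℂ] V₁ := (ContinuousLinearMap.fst ℂ V₁ V₂).comp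
    (WithLp.prodContinuousLinearEquiv 2 ℂ V₁ V₂ : WithLp 2 (V₁ × V₂) →L[ℂ] (V₁ × V₂)) with hP
  have hPapply : ∀ w : WithLp 2 (V₁ × V₂), P w = (ofLp w).1 := fun w => rfl
  have hsurj : Surjective P := fun a => ⟨toLp 2 (a, 0), by rw [hPapply]⟩
  have h1 := SCV.pointOrder_comp_clm_of_surjective P hsurj f z
  simp only [hPapply] at h1
  exact h1

omit [Fintype ι₁] [Fintype ι₂] [DecidableEq ι₁] [DecidableEq ι₂] [InnerProductSpace ℂ E₁] [FiniteDimensional ℂ E₁]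
  [InnerProductSpace ℂ E₂] [FiniteDimensional ℂ E₂] [NormedAddCommGroup E₁] [NormedAddCommGroup E₂] in
/-- `ord_z(ϑ₂ ∘ pr₂) = ord_{z₂}(ϑ₂)` on `V₁ × V₂`. [cite: Chirka1989, §1.5 (p. 10–11)] [cite: Fulton1998, §1.7 Prop. 1.7] -/
theorem _root_.Literature.Geometry.Kaehler.SCV.pointOrder_comp_snd_ofLp
    {V₁ V₂ : Type*} [NormedAddCommGroup V₁] [NormedSpace ℂ V₁] [NormedAddCommGroup V₂] [NormedSpace ℂ V₂]
    (f : V₂ → ℂ) (z : WithLp 2 (V₁ × V₂)) :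
    SCV.pointOrder (fun w : WithLp 2 (V₁ × V₂) => f (ofLp w).2) z = SCV.pointOrder f (ofLp z).2 := by
  set P : WithLp 2 (V₁ × V₂) →L[ℂ] V₂ := (ContinuousLinearMap.snd ℂ V₁ V₂).comp
    (WithLp.prodContinuousLinearEquiv 2 ℂ V₁ V₂ : WithLp 2 (V₁ × V₂) →L[ℂ] (V₁ × V₂)) with hP
  have hPapply : ∀ w : WithLp 2 (V₁ × V₂), P w = (ofLp w).2 := fun w => rfl
  have hsurj : Surjective P := fun a => ⟨toLp 2 (0, a), by rw [hPapply]⟩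
  have h1 := SCV.pointOrder_comp_clm_of_surjective P hsurj f z
  simp only [hPapply] at h1
  exact h1

variable {Φ₁ Φ₂}

include e₁ e₂ h₁ h₂ in
/-- **`mult_{π(z)}(pr₁^* D₁) = mult_{π₁(z₁)}(D₁)`** on `X₁ × X₂ = ComplexTorus (prodPeriodL2 Φ₁ Φ₂)` for
`D₁ ∈ |L(H₁, χ₁)|` (`pr₁^*(ϑ₁) = (ϑ₁ ∘ pr₁)`, A2-161). [cite: Fulton1998, §1.7 Prop. 1.7 and §1.10 Prop. 1.10 (a)] [cite: Lange2023AbelianVarietiesComplex, §2.1.6 Exercise (7) (p. 88)] -/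
theorem divisorMultAt_fstPullbackChain_cover (hη₁ : IsNSForm Φ₁ η₁) (hχ₁ : IsSemicharacter Φ₁ η₁ χ₁)
    {D₁ : HolomorphicChain 𝓘(ℂ, E₁) (ComplexTorus Φ₁) d₁} (hD₁ : D₁ ∈ linearSystem Φ₁ d₁ η₁ χ₁)
    (z : WithLp 2 (E₁ × E₂)) :
    divisorMultAt (prodPeriodL2 Φ₁ Φ₂) (d₁ + d₂ + 1) (fstPullbackChain Φ₁ Φ₂ e₂ h₂ D₁)
        (cover (prodPeriodL2 Φ₁ Φ₂) z) =
      divisorMultAt Φ₁ d₁ D₁ (cover Φ₁ (ofLp z).1) := by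
  obtain ⟨ϑ₁, hϑ₁, hϑ₁0, rfl⟩ := hD₁
  have hη : IsNSForm (prodPeriodL2 Φ₁ Φ₂)
      (pullbackForm (WithLp.prodContinuousLinearEquiv 2 ℂ E₁ E₂ : WithLp 2 (E₁ × E₂) →L[ℂ] (E₁ × E₂))
        (prodForm η₁ (0 : E₂ [⋀^Fin 2]→L[ℝ] ℝ))) :=
    hη₁.boxProdL2 Φ₁ Φ₂ (isNSForm_zero Φ₂)
  have hχ : IsSemicharacter (prodPeriodL2 Φ₁ Φ₂)
      (pullbackForm (WithLp.prodContinuousLinearEquiv 2 ℂ E₁ E₂ : WithLp 2 (E₁ × E₂) →L[ℂ] (E₁ × E₂))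
        (prodForm η₁ (0 : E₂ [⋀^Fin 2]→L[ℝ] ℝ)))
      (fun m ↦ χ₁ (fun i ↦ m (Sum.inl i))) := by
    simpa using hχ₁.boxProdL2 Φ₁ Φ₂ (isSemicharacter_one Φ₂)
  rw [← divisorChain_comp_fst Φ₁ Φ₂ e₁ e₂ h₁ h₂ hη₁ hχ₁ hϑ₁ hϑ₁0,
    divisorMultAt_divisorChain_cover (finSumFinEquiv.symm.trans (e₁.sumCongr e₂)) (two_mul_add_eq'' h₁ h₂)
      hη hχ (comp_fst_mem_thetaFunctions Φ₁ Φ₂ hϑ₁) (comp_fst_ne_zero' hϑ₁0) z,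
    divisorMultAt_divisorChain_cover e₁ h₁ hη₁ hχ₁ hϑ₁ hϑ₁0, SCV.pointOrder_comp_fst_ofLp]

include e₁ e₂ h₁ h₂ in
/-- **`mult_{π(z)}(pr₂^* D₂) = mult_{π₂(z₂)}(D₂)`.** [cite: Fulton1998, §1.7 Prop. 1.7 and §1.10 Prop. 1.10 (a)] [cite: Lange2023AbelianVarietiesComplex, §2.1.6 Exercise (7) (p. 88)] -/
theorem divisorMultAt_sndPullbackChain_cover (hη₂ : IsNSForm Φ₂ η₂) (hχ₂ : IsSemicharacter Φ₂ η₂ χ₂)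
    {D₂ : HolomorphicChain 𝓘(ℂ, E₂) (ComplexTorus Φ₂) d₂} (hD₂ : D₂ ∈ linearSystem Φ₂ d₂ η₂ χ₂)
    (z : WithLp 2 (E₁ × E₂)) :
    divisorMultAt (prodPeriodL2 Φ₁ Φ₂) (d₁ + d₂ + 1) (sndPullbackChain Φ₁ Φ₂ e₁ h₁ D₂)
        (cover (prodPeriodL2 Φ₁ Φ₂) z) =
      divisorMultAt Φ₂ d₂ D₂ (cover Φ₂ (ofLp z).2) := by
  obtain ⟨ϑ₂, hϑ₂, hϑ₂0, rfl⟩ := hD₂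
  have hη : IsNSForm (prodPeriodL2 Φ₁ Φ₂)
      (pullbackForm (WithLp.prodContinuousLinearEquiv 2 ℂ E₁ E₂ : WithLp 2 (E₁ × E₂) →L[ℂ] (E₁ × E₂))
        (prodForm (0 : E₁ [⋀^Fin 2]→L[ℝ] ℝ) η₂)) :=
    (isNSForm_zero Φ₁).boxProdL2 Φ₁ Φ₂ hη₂
  have hχ : IsSemicharacter (prodPeriodL2 Φ₁ Φ₂)
      (pullbackForm (WithLp.prodContinuousLinearEquiv 2 ℂ E₁ E₂ : WithLp 2 (E₁ × E₂) →L[ℂ] (E₁ × E₂))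
        (prodForm (0 : E₁ [⋀^Fin 2]→L[ℝ] ℝ) η₂))
      (fun m ↦ χ₂ (fun j ↦ m (Sum.inr j))) := by
    simpa using (isSemicharacter_one Φ₁).boxProdL2 Φ₁ Φ₂ hχ₂
  rw [← divisorChain_comp_snd Φ₁ Φ₂ e₁ e₂ h₁ h₂ hη₂ hχ₂ hϑ₂ hϑ₂0,
    divisorMultAt_divisorChain_cover (finSumFinEquiv.symm.trans (e₁.sumCongr e₂)) (two_mul_add_eq'' h₁ h₂)
      hη hχ (comp_snd_mem_thetaFunctions Φ₁ Φ₂ hϑ₂) (comp_snd_ne_zero' hϑ₂0) z,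
    divisorMultAt_divisorChain_cover e₂ h₂ hη₂ hχ₂ hϑ₂ hϑ₂0, SCV.pointOrder_comp_snd_ofLp]

include e₁ e₂ h₁ h₂ in
/-- **`mult_{π(z)}(pr₁^* D₁ + pr₂^* D₂) = mult_{π₁(z₁)}(D₁) + mult_{π₂(z₂)}(D₂)`** — the multiplicity of
the divisor `D₁ × X₂ + X₁ × D₂` (Lemma 5.1.1's `Θ₁ × X₂ + X₁ × D`, Exercise 2.1.6 (7)) at a point of the
product. [cite: Lange2023AbelianVarietiesComplex, §5.1 Lemma 5.1.1 and §2.1.6 Exercise (7) (p. 88)] [cite: Chirka1989, §1.5 (p. 11)] [cite: Fulton1998, §1.10 Prop. 1.10 (a)] -/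
theorem divisorMultAt_fstPullbackChain_add_sndPullbackChain_cover (hη₁ : IsNSForm Φ₁ η₁)
    (hχ₁ : IsSemicharacter Φ₁ η₁ χ₁) (hη₂ : IsNSForm Φ₂ η₂) (hχ₂ : IsSemicharacter Φ₂ η₂ χ₂)
    {D₁ : HolomorphicChain 𝓘(ℂ, E₁) (ComplexTorus Φ₁) d₁} (hD₁ : D₁ ∈ linearSystem Φ₁ d₁ η₁ χ₁)
    {D₂ : HolomorphicChain 𝓘(ℂ, E₂) (ComplexTorus Φ₂) d₂} (hD₂ : D₂ ∈ linearSystem Φ₂ d₂ η₂ χ₂)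
    (z : WithLp 2 (E₁ × E₂)) :
    divisorMultAt (prodPeriodL2 Φ₁ Φ₂) (d₁ + d₂ + 1)
        (fstPullbackChain Φ₁ Φ₂ e₂ h₂ D₁ + sndPullbackChain Φ₁ Φ₂ e₁ h₁ D₂) (cover (prodPeriodL2 Φ₁ Φ₂) z) =
      divisorMultAt Φ₁ d₁ D₁ (cover Φ₁ (ofLp z).1) + divisorMultAt Φ₂ d₂ D₂ (cover Φ₂ (ofLp z).2) := by
  have hηA : IsNSForm (prodPeriodL2 Φ₁ Φ₂)
      (pullbackForm (WithLp.prodContinuousLinearEquiv 2 ℂ E₁ E₂ : WithLp 2 (E₁ × E₂) →L[ℂ] (E₁ × E₂))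
        (prodForm η₁ (0 : E₂ [⋀^Fin 2]→L[ℝ] ℝ))) :=
    hη₁.boxProdL2 Φ₁ Φ₂ (isNSForm_zero Φ₂)
  have hχA : IsSemicharacter (prodPeriodL2 Φ₁ Φ₂)
      (pullbackForm (WithLp.prodContinuousLinearEquiv 2 ℂ E₁ E₂ : WithLp 2 (E₁ × E₂) →L[ℂ] (E₁ × E₂))
        (prodForm η₁ (0 : E₂ [⋀^Fin 2]→L[ℝ] ℝ)))
      (fun m ↦ χ₁ (fun i ↦ m (Sum.inl i))) := by
    simpa using hχ₁.boxProdL2 Φ₁ Φ₂ (isSemicharacter_one Φ₂)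
  have hηB : IsNSForm (prodPeriodL2 Φ₁ Φ₂)
      (pullbackForm (WithLp.prodContinuousLinearEquiv 2 ℂ E₁ E₂ : WithLp 2 (E₁ × E₂) →L[ℂ] (E₁ × E₂))
        (prodForm (0 : E₁ [⋀^Fin 2]→L[ℝ] ℝ) η₂)) :=
    (isNSForm_zero Φ₁).boxProdL2 Φ₁ Φ₂ hη₂
  have hχB : IsSemicharacter (prodPeriodL2 Φ₁ Φ₂)
      (pullbackForm (WithLp.prodContinuousLinearEquiv 2 ℂ E₁ E₂ : WithLp 2 (E₁ × E₂) →L[ℂ] (E₁ × E₂))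
        (prodForm (0 : E₁ [⋀^Fin 2]→L[ℝ] ℝ) η₂))
      (fun m ↦ χ₂ (fun j ↦ m (Sum.inr j))) := by
    simpa using (isSemicharacter_one Φ₁).boxProdL2 Φ₁ Φ₂ hχ₂
  rw [divisorMultAt_add (finSumFinEquiv.symm.trans (e₁.sumCongr e₂)) (two_mul_add_eq'' h₁ h₂) hηA hχA hηB hχB
      (fstPullbackChain_mem_linearSystem Φ₁ Φ₂ e₁ e₂ h₁ h₂ hη₁ hχ₁ hD₁)
      (sndPullbackChain_mem_linearSystem Φ₁ Φ₂ e₁ e₂ h₁ h₂ hη₂ hχ₂ hD₂),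
    divisorMultAt_fstPullbackChain_cover e₁ e₂ h₁ h₂ hη₁ hχ₁ hD₁,
    divisorMultAt_sndPullbackChain_cover e₁ e₂ h₁ h₂ hη₂ hχ₂ hD₂]

include e₁ e₂ h₁ h₂ in
/-- **`Sing(D₁ × X₂ + X₁ × D₂) = (|D₁| × |D₂|) ∪ (Sing D₁ × X₂) ∪ (X₁ × Sing D₂)`**, pointwise: the box
divisor has multiplicity `≥ 2` at `π(z₁, z₂)` iff `D₁` has multiplicity `≥ 2` at `π₁ z₁`, or `D₂` at
`π₂ z₂`, or `π₁ z₁ ∈ |D₁|` and `π₂ z₂ ∈ |D₂|` — for a decomposable p.p.a.v. `Θ = Θ₁ × X₂ + X₁ × Θ₂` is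
singular along `Θ₁ × Θ₂` ("`𝒜_g^{dec} ⊂ N_{g−2,g}`"). [cite: Grushevsky2012SchottkyProblem, §5 (p. 11)] [cite: Lange2023AbelianVarietiesComplex, §5.1 Lemma 5.1.1] [cite: Chirka1989, §1.5 (p. 11)] -/
theorem two_le_divisorMultAt_boxProd_iff (hη₁ : IsNSForm Φ₁ η₁) (hχ₁ : IsSemicharacter Φ₁ η₁ χ₁)
    (hη₂ : IsNSForm Φ₂ η₂) (hχ₂ : IsSemicharacter Φ₂ η₂ χ₂)
    {D₁ : HolomorphicChain 𝓘(ℂ, E₁) (ComplexTorus Φ₁) d₁} (hD₁ : D₁ ∈ linearSystem Φ₁ d₁ η₁ χ₁)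
    {D₂ : HolomorphicChain 𝓘(ℂ, E₂) (ComplexTorus Φ₂) d₂} (hD₂ : D₂ ∈ linearSystem Φ₂ d₂ η₂ χ₂)
    (z : WithLp 2 (E₁ × E₂)) :
    2 ≤ divisorMultAt (prodPeriodL2 Φ₁ Φ₂) (d₁ + d₂ + 1)
        (fstPullbackChain Φ₁ Φ₂ e₂ h₂ D₁ + sndPullbackChain Φ₁ Φ₂ e₁ h₁ D₂) (cover (prodPeriodL2 Φ₁ Φ₂) z) ↔
      2 ≤ divisorMultAt Φ₁ d₁ D₁ (cover Φ₁ (ofLp z).1) ∨ 2 ≤ divisorMultAt Φ₂ d₂ D₂ (cover Φ₂ (ofLp z).2) ∨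
        (cover Φ₁ (ofLp z).1 ∈ D₁.support ∧ cover Φ₂ (ofLp z).2 ∈ D₂.support) := by
  rw [divisorMultAt_fstPullbackChain_add_sndPullbackChain_cover e₁ e₂ h₁ h₂ hη₁ hχ₁ hη₂ hχ₂ hD₁ hD₂,
    two_le_add_iff, one_le_divisorMultAt_iff e₁ h₁ hη₁ hχ₁ hD₁, one_le_divisorMultAt_iff e₂ h₂ hη₂ hχ₂ hD₂]

include e₁ e₂ h₁ h₂ in
/-- **`|D₁| × |D₂| ⊆ Sing(D₁ × X₂ + X₁ × D₂)`**: at a point over `|D₁| × |D₂|` the box divisor has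
multiplicity `≥ 2` (`Θ₁ × Θ₂ ⊆ Sing Θ` for a product of principally polarised abelian varieties).
[cite: Grushevsky2012SchottkyProblem, §5 (p. 11: "`𝒜_g^{dec} ⊂ N_{g−2,g}`")] [cite: Lange2023AbelianVarietiesComplex, §5.1 Lemma 5.1.1] -/
theorem two_le_divisorMultAt_boxProd_of_mem_support (hη₁ : IsNSForm Φ₁ η₁) (hχ₁ : IsSemicharacter Φ₁ η₁ χ₁)
    (hη₂ : IsNSForm Φ₂ η₂) (hχ₂ : IsSemicharacter Φ₂ η₂ χ₂)
    {D₁ : HolomorphicChain 𝓘(ℂ, E₁) (ComplexTorus Φ₁) d₁} (hD₁ : D₁ ∈ linearSystem Φ₁ d₁ η₁ χ₁)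
    {D₂ : HolomorphicChain 𝓘(ℂ, E₂) (ComplexTorus Φ₂) d₂} (hD₂ : D₂ ∈ linearSystem Φ₂ d₂ η₂ χ₂)
    {z : WithLp 2 (E₁ × E₂)} (hz₁ : cover Φ₁ (ofLp z).1 ∈ D₁.support) (hz₂ : cover Φ₂ (ofLp z).2 ∈ D₂.support) :
    2 ≤ divisorMultAt (prodPeriodL2 Φ₁ Φ₂) (d₁ + d₂ + 1)
        (fstPullbackChain Φ₁ Φ₂ e₂ h₂ D₁ + sndPullbackChain Φ₁ Φ₂ e₁ h₁ D₂) (cover (prodPeriodL2 Φ₁ Φ₂) z) :=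
  (two_le_divisorMultAt_boxProd_iff e₁ e₂ h₁ h₂ hη₁ hχ₁ hη₂ hχ₂ hD₁ hD₂ z).2 (Or.inr (Or.inr ⟨hz₁, hz₂⟩))

include e₁ e₂ h₁ h₂ in
/-- **`mult = 1` exactly off the "crossings": `mult_{π(z)}(D₁ × X₂ + X₁ × D₂) = 1 ⟺` (`mult_{π₁ z₁}(D₁) = 1`
and `π₂ z₂ ∉ |D₂|`) or (`π₁ z₁ ∉ |D₁|` and `mult_{π₂ z₂}(D₂) = 1`)** — the smooth points of the box
divisor. [cite: Lange2023AbelianVarietiesComplex, §5.1 Lemma 5.1.1 and §2.1.2 (p. 79 L23)] [cite: Chirka1989, §1.5 (p. 11)] -/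
theorem divisorMultAt_boxProd_eq_one_iff (hη₁ : IsNSForm Φ₁ η₁) (hχ₁ : IsSemicharacter Φ₁ η₁ χ₁)
    (hη₂ : IsNSForm Φ₂ η₂) (hχ₂ : IsSemicharacter Φ₂ η₂ χ₂)
    {D₁ : HolomorphicChain 𝓘(ℂ, E₁) (ComplexTorus Φ₁) d₁} (hD₁ : D₁ ∈ linearSystem Φ₁ d₁ η₁ χ₁)
    {D₂ : HolomorphicChain 𝓘(ℂ, E₂) (ComplexTorus Φ₂) d₂} (hD₂ : D₂ ∈ linearSystem Φ₂ d₂ η₂ χ₂)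
    (z : WithLp 2 (E₁ × E₂)) :
    divisorMultAt (prodPeriodL2 Φ₁ Φ₂) (d₁ + d₂ + 1)
        (fstPullbackChain Φ₁ Φ₂ e₂ h₂ D₁ + sndPullbackChain Φ₁ Φ₂ e₁ h₁ D₂) (cover (prodPeriodL2 Φ₁ Φ₂) z) = 1 ↔
      (divisorMultAt Φ₁ d₁ D₁ (cover Φ₁ (ofLp z).1) = 1 ∧ cover Φ₂ (ofLp z).2 ∉ D₂.support) ∨
        (cover Φ₁ (ofLp z).1 ∉ D₁.support ∧ divisorMultAt Φ₂ d₂ D₂ (cover Φ₂ (ofLp z).2) = 1) := by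
  rw [divisorMultAt_fstPullbackChain_add_sndPullbackChain_cover e₁ e₂ h₁ h₂ hη₁ hχ₁ hη₂ hχ₂ hD₁ hD₂,
    ← divisorMultAt_eq_zero_iff e₂ h₂ hη₂ hχ₂ hD₂, ← divisorMultAt_eq_zero_iff e₁ h₁ hη₁ hχ₁ hD₁]
  obtain ⟨a, ha⟩ := ENat.ne_top_iff_exists.1 (divisorMultAt_ne_top e₁ h₁ hη₁ hχ₁ hD₁ (cover Φ₁ (ofLp z).1))
  obtain ⟨b, hb⟩ := ENat.ne_top_iff_exists.1 (divisorMultAt_ne_top e₂ h₂ hη₂ hχ₂ hD₂ (cover Φ₂ (ofLp z).2))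
  rw [← ha, ← hb]
  norm_cast
  omega

end BoxProduct

end ComplexTorus

end Literature.Geometry.Kaehler

end
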